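import Summits.NavierStokesRegularity.FluidComputer.PalasekTowerGermHost

/-!
# The germ host, V: the EXPLICIT germ schedule `(U, ρ, σ₀, ε, c₄)` — a nameable `S*` for certificates

Cell `ns-blowup`, seat `ns-blowup-ecbridge-3` (g3); GROUP C «BRIDGE SUPPORT» of the route
`PalasekTowerBreakdown` (crux `EpisodeBaseG`, item stmt-NavierStokesRegularity-19179, R2 of record).
LABEL: E–C typing (KERNEL construction: a typed CERTIFICATE SLOT with all parameters explicit + the
prescribed level-`0` host of every design filling it). WHAT THIS IS NOT: not Navier–Stokes evidence —
a PRESCRIBED host; nothing about the flow after `τ₀`, `FirstEpisodeD`, `RungG 1` or blow-up.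

## What and why

`PalasekTowerGermHost` (p443639) builds, for every profile in the slot `LevelZeroData U ρ`, the germ
schedule `h.schedule c₄` — but its width `σ₀ = h.width` (of the anchored segment) and fade length
`ε = h.fadeLen` are CHOICES (`Classical.choose` of compactness arguments), so `S* := h.schedule c₄` is a
theorem-level object, not a numerically nameable one. A certified window run (the open child
`FirstEpisodeD (HostClass.exact S*)`, or the window form of seat ecbridge-6) needs `S*` with EVERY
parameter explicit. This file is that interface:

* §1 `LineGermData U ρ σ₀ ε c₄`: the profile data of `LevelZeroData` with the strict anchor test
  REPLACED by its two quantitative consequences at explicit parameters — the LINE ANCHOR at width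
  `σ₀ > 0` (`‖U + σV‖ < Y₀` for `−σ₀ < σ < 0`, `V = P(ΔU − (U·∇)U)`) and the RESIDUAL BOUND on the
  fade window (`‖germResid t‖ ≤ c₄Y₀` on `[1, 1 + ε]`, `0 < ε ≤ w₀`), `0 < c₄ ≤ 1` — two global
  inequalities a certificate establishes the same way as the readouts;
* §2 the EXPLICIT schedule `d.schedule = Schedule.ofBox 0 (lineForce U σ₀ ε) ρ c₄`
  (`lineForce U σ₀ ε = germForce 1 U αhost (βhost σ₀) (1+ε) ε`), its stage (velocity
  `lineVel U σ₀ = germ 1 U αhost (βhost σ₀)`, `u(τ₀) = U`, `∂ₜu(τ₀) = V`, `f(τ₀) = 0`, restart states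
  `lineVel U σ₀ t = U + σline σ₀ t • V` for `t ≥ 1/2`) and **`LineGermData.hostPreparationD_exact`**;
* §3 the link: `LevelZeroData U ρ` yields `LineGermData U ρ h.width (h.fadeLen hc₄) c₄` and the two
  schedules COINCIDE (`LevelZeroData.schedule_eq`), so p443639 is the `∃(σ₀, ε)` shadow of this file.

References: S. Palasek, arXiv:2605.13827 §3.3 (host preparation before the first readout)
[cite: Palasek2026ElementaryModel, §3.3]; C. L. Fefferman, Clay problem description, (4)–(7)
[cite: FeffermanClay2006, (4) (5) (6) (7)].
-/

noncomputable section

namespace Summit.NavierStokesRegularity.FluidComputer.PalasekTowerClayBridge.Germ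

open Set Function Filter Topology InnerProductSpace Metric MeasureTheory
open scoped Topology ContDiff RealInnerProductSpace ENNReal

open Literature.Analysis.FluidPDE

/-! ## §1 The explicit certificate slot -/

/-- **EXPLICIT GERM DESIGN DATA** `(U, ρ, σ₀, ε, c₄)`: the level-`0` readouts of `U` (as in
`LevelZeroData`), the LINE ANCHOR at the explicit width `σ₀ > 0`, the RESIDUAL BOUND `≤ c₄ Y₀` of the
line germ on the explicit fade window `[1, 1 + ε]` (`0 < ε ≤ w₀`), and `0 < c₄ ≤ 1`. Every field is a
closed-form statement about `U` and the four numbers — the certificate interface of a named `S*`.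
[cite: Palasek2026ElementaryModel, §3.3] -/
structure LineGermData (U : EuclideanSpace ℝ (Fin 3) → EuclideanSpace ℝ (Fin 3)) (ρ σ₀ ε c₄ : ℝ) :
    Prop where
  /-- the profile is smooth -/
  smooth : ContDiff ℝ ∞ U
  /-- … supported in the closed ball of radius `ρ` -/
  support : tsupport U ⊆ closedBall 0 ρ
  /-- … and divergence free -/
  divFree : VectorCalculus.IsDivFree U
  /-- speed ceiling `Y₀` everywhere -/
  ceiling : ∀ x, ‖U x‖ ≤ TowerRates.wide.Y 0
  /-- speed floor `Y₀` attained in the ball -/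
  floor : ∃ x, ‖x‖ ≤ ρ ∧ TowerRates.wide.Y 0 ≤ ‖U x‖
  /-- strain floor `A₀` attained in the ball -/
  strain : ∃ x, ‖x‖ ≤ ρ ∧ TowerRates.wide.A 0 ≤ ‖fderiv ℝ U x‖
  /-- the level-`0` core loop -/
  core : ∃ (x : EuclideanSpace ℝ (Fin 3)) (γ : ℝ → EuclideanSpace ℝ (Fin 3)),
    ‖x‖ ≤ ρ ∧ ContDiff ℝ 1 γ ∧ γ 0 = γ 1 ∧
      (∀ s ∈ Icc (0 : ℝ) 1, γ s ∈ closedBall x (1 / TowerRates.wide.N 0)) ∧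
      (∀ s ∈ Icc (0 : ℝ) 1, ‖deriv γ s‖ ≤ 8 * Real.pi / TowerRates.wide.N 0) ∧
      TowerRates.wide.N 0 ^ (TowerRates.wide.β - 2) ≤ circulation U γ
  /-- the width of the anchored segment is positive -/
  width_pos : 0 < σ₀
  /-- the LINE ANCHOR at width `σ₀` -/
  line : ∀ σ : ℝ, -σ₀ < σ → σ < 0 → ∀ x, ‖U x + σ • accel 1 U x‖ < TowerRates.wide.Y 0
  /-- the fade length is positive -/
  fade_pos : 0 < ε
  /-- … and at most the first growth window -/
  fade_le : ε ≤ Host.wfirst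
  /-- the push constant is positive -/
  push_pos : 0 < c₄
  /-- … and at most `c₁ = 1` -/
  push_le : c₄ ≤ 1
  /-- the RESIDUAL BOUND of the line germ on the fade window -/
  window : ∀ t ∈ Icc (1 : ℝ) (1 + ε), ∀ x : EuclideanSpace ℝ (Fin 3),
    ‖germResid 1 U αhost (βhost σ₀) t x‖ ≤ c₄ * TowerRates.wide.Y 0

/-- **The line velocity** at width `σ₀` (unit viscosity): `germ 1 U αhost (βhost σ₀)`, i.e.
`αhost t • (U + σline σ₀ t • V)`. [folklore] -/
def lineVel (U : EuclideanSpace ℝ (Fin 3) → EuclideanSpace ℝ (Fin 3)) (σ₀ : ℝ) :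
    ℝ → EuclideanSpace ℝ (Fin 3) → EuclideanSpace ℝ (Fin 3) :=
  germ 1 U αhost (βhost σ₀)

/-- **The line pressure** `β' π − β² |∇π|²/2`, `β = βhost σ₀`. [folklore] -/
def linePres (U : EuclideanSpace ℝ (Fin 3) → EuclideanSpace ℝ (Fin 3)) (σ₀ : ℝ) :
    ℝ → EuclideanSpace ℝ (Fin 3) → ℝ :=
  germPres 1 U (βhost σ₀)

/-- **The line force**: the residual of the line germ faded on `[1, 1 + ε]`. [folklore] -/
def lineForce (U : EuclideanSpace ℝ (Fin 3) → EuclideanSpace ℝ (Fin 3)) (σ₀ ε : ℝ) :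
    ℝ → EuclideanSpace ℝ (Fin 3) → EuclideanSpace ℝ (Fin 3) :=
  germForce 1 U αhost (βhost σ₀) (1 + ε) ε

/-- `u(0) = 0` on the line. [folklore] -/
theorem lineVel_zero (U : EuclideanSpace ℝ (Fin 3) → EuclideanSpace ℝ (Fin 3)) (σ₀ : ℝ) :
    lineVel U σ₀ 0 = 0 := germ_line_zero 1 U σ₀

/-- **`u(τ₀) = U`** on the line. [folklore] -/
theorem lineVel_one (U : EuclideanSpace ℝ (Fin 3) → EuclideanSpace ℝ (Fin 3)) (σ₀ : ℝ) :
    lineVel U σ₀ 1 = U := germ_line_one 1 U σ₀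

/-- **For `t ≥ 1/2` the line velocity is `U + σline σ₀ t • V`** — the EXPLICIT restart states of a
window run (`V = accel 1 U = P(ΔU − (U·∇)U)`). [folklore] -/
theorem lineVel_of_half_le (U : EuclideanSpace ℝ (Fin 3) → EuclideanSpace ℝ (Fin 3)) (σ₀ : ℝ)
    {t : ℝ} (ht : 1 / 2 ≤ t) (x : EuclideanSpace ℝ (Fin 3)) :
    lineVel U σ₀ t x = U x + σline σ₀ t • accel 1 U x := by
  rw [lineVel, germ_eq_smul_line, αhost_of_half_le ht, one_smul]

namespace LineGermData

variable {U : EuclideanSpace ℝ (Fin 3) → EuclideanSpace ℝ (Fin 3)} {ρ σ₀ ε c₄ : ℝ}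
  (d : LineGermData U ρ σ₀ ε c₄)
include d

/-- The profile, through the abstract slot minus the anchor test, has compact support (the proof term
of `LevelZeroData.hasCompactSupport`, restated inline to keep the two slots independent). -/
private theorem hUc : HasCompactSupport U :=
  (isCompact_closedBall (0 : EuclideanSpace ℝ (Fin 3)) ρ).of_isClosed_subset (isClosed_tsupport U)
    d.support

/-! ## §2 The explicit schedule, its stage, host preparation -/

/-- The force is jointly smooth. [cite: FeffermanClay2006, (6)] -/
theorem contDiff_uncurry_force : ContDiff ℝ ∞ (uncurry (lineForce U σ₀ ε)) :=
  contDiff_uncurry_germForce d.smooth d.hUc contDiff_αhost (contDiff_βhost _)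

/-- The force has compact space-time support. [cite: FeffermanClay2006, (5)] -/
theorem hasCompactSupport_force : HasCompactSupport (uncurry (lineForce U σ₀ ε)) :=
  hasCompactSupport_germForce d.smooth d.hUc d.fade_pos d.support
    (fun _ ht => αhost_of_nonpos ht) (fun _ ht => βhost_of_nonpos ht)

/-- The force vanishes from `τ₁ = 1 + w₀` on. [folklore] -/
theorem force_eq_zero_of_ge : ∀ t, Host.τfirst ≤ t → ∀ x, lineForce U σ₀ ε t x = 0 := by
  intro t ht x
  have h1 : 1 + ε ≤ t := by rw [Host.τfirst_eq] at ht; linarith [d.fade_le]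
  exact germForce_eq_zero_of_ge d.fade_pos h1 x

/-- `‖force‖ ≤ c₄ Y₀` on `[1, τ₁]`. [folklore] -/
theorem norm_force_le :
    ∀ t ∈ Icc (1 : ℝ) Host.τfirst, ∀ x, ‖lineForce U σ₀ ε t x‖ ≤ c₄ * TowerRates.wide.Y 0 :=
  fun _ ht x => norm_germForce_le_of_window d.fade_pos (mul_pos d.push_pos Host.wide_Y_zero_pos).le
    d.window ht.1 x

/-- The force is confined to the ball. [folklore] -/
theorem force_eq_zero_of_norm_gt (t : ℝ) (x : EuclideanSpace ℝ (Fin 3)) (hx : ρ < ‖x‖) :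
    (lineForce U σ₀ ε) t x = 0 :=
  germForce_eq_zero_of_norm_gt d.smooth d.hUc d.support t hx

/-- On the slab `t ≤ 1` the force is the residual. [folklore] -/
theorem force_eq_germResid {t : ℝ} (ht : t ≤ 1) (x : EuclideanSpace ℝ (Fin 3)) :
    (lineForce U σ₀ ε) t x = germResid 1 U αhost (βhost σ₀) t x :=
  germForce_eq_germResid d.fade_pos (by show t ≤ 1 + ε - ε; linarith) x

/-- **`f(τ₀) = 0`.** [folklore] -/
theorem force_one (x : EuclideanSpace ℝ (Fin 3)) : lineForce U σ₀ ε 1 x = 0 := by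
  rw [d.force_eq_germResid le_rfl]
  exact germResid_eq_zero_of_matched αhost_one deriv_αhost_one (βhost_one _)
    (deriv_βhost_one d.width_pos.ne') x

/-- **THE EXPLICIT GERM SCHEDULE `S*(U, ρ, σ₀, ε, c₄)`.** [cite: Palasek2026ElementaryModel, §3.3] -/
def schedule : Schedule TowerRates.wide :=
  Schedule.ofBox 0 (lineForce U σ₀ ε) ρ c₄ d.push_le contDiff_const HasCompactSupport.zero
    d.contDiff_uncurry_force d.hasCompactSupport_force d.force_eq_zero_of_ge d.norm_force_le

/-- RIGID. [folklore] -/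
theorem schedule_rigid : d.schedule.Rigid := Schedule.ofBox_rigid _ _ _ _ _ _ _

/-- QUIET. [folklore] -/
theorem schedule_quiet : d.schedule.Quiet := Schedule.ofBox_quiet _ _ _ _ _ _ _

/-- PINNED (`Λ = 8`, `θ = 6/5`). [folklore] -/
theorem schedule_pins : d.schedule.Pins 8 (6 / 5) :=
  Schedule.ofBox_pins _ _ _ _ _ _ _ (fun _ _ => rfl) d.force_eq_zero_of_norm_gt

/-- `τ 0 = 1`. [folklore] -/
theorem schedule_τ_zero : d.schedule.τ 0 = 1 := Host.windowTime_zero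

/-- `τ 1 = τ₁ = 1 + w₀`. [folklore] -/
theorem schedule_τ_one : d.schedule.τ 1 = Host.τfirst := rfl

/-- The force of the schedule. [folklore] -/
theorem schedule_f : d.schedule.f = (lineForce U σ₀ ε) := rfl

/-- The radius of the schedule is `ρ`. [folklore] -/
theorem schedule_radius : d.schedule.radius = ρ := rfl

/-- `c₁ = 1`. [folklore] -/
theorem schedule_c₁ : d.schedule.c₁ = 1 := rfl

/-- `c₂ = 5/3`. [folklore] -/
theorem schedule_c₂ : d.schedule.c₂ = 5 / 3 := rfl

/-- The germ solves forced NS with the schedule's force on `[0, 1]`. [cite: FeffermanClay2006, (1) (2)] -/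
theorem isClassicalNSSolutionOn_vel :
    IsClassicalNSSolutionOn (Icc 0 1) 1 d.schedule.f (lineVel U σ₀) (linePres U σ₀) := by
  have hb := isClassicalNSSolutionOn_germ (ν := 1) (α := αhost) (β := βhost σ₀) d.smooth
    d.hUc contDiff_αhost (contDiff_βhost _) d.divFree one_pos
  refine ⟨hb.smooth_velocity, hb.smooth_pressure, fun t ht x => ?_, hb.divFree⟩
  have hf : d.schedule.f t x = germResid 1 U αhost (βhost σ₀) t x := d.force_eq_germResid ht.2 x
  rw [hf]
  exact hb.momentum t ht x

/-- **`∂ₜu(τ₀) = V`.** [folklore] -/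
theorem timeDerivWithin_vel_one (x : EuclideanSpace ℝ (Fin 3)) :
    timeDerivWithin (Icc 0 1) (lineVel U σ₀) 1 x = accel 1 U x := by
  rw [lineVel, timeDerivWithin_germ (contDiff_αhost.differentiable (by simp))
    ((contDiff_βhost _).differentiable (by simp)) one_pos ⟨zero_le_one, le_rfl⟩,
    deriv_αhost_one, deriv_βhost_one d.width_pos.ne', zero_smul, one_smul, zero_add]

/-- THE GLOBAL ANCHOR. [folklore] -/
theorem norm_vel_lt {t : ℝ} (ht : t < 1) (x : EuclideanSpace ℝ (Fin 3)) :
    ‖(lineVel U σ₀) t x‖ < TowerRates.wide.Y 0 :=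
  norm_germ_lt d.width_pos d.line ht x

/-- The ceiling on the slab. [folklore] -/
theorem norm_vel_le {t : ℝ} (ht : t ≤ 1) (x : EuclideanSpace ℝ (Fin 3)) :
    ‖(lineVel U σ₀) t x‖ ≤ TowerRates.wide.Y 0 :=
  norm_germ_le d.width_pos d.ceiling d.line ht x

/-- Finite energy on the slab. [cite: FeffermanClay2006, (7)] -/
theorem energy_vel :
    ∃ C : ℝ≥0∞, C < ⊤ ∧ ∀ t ∈ Icc (0 : ℝ) 1, ∫⁻ x, ‖lineVel U σ₀ t x‖ₑ ^ 2 ≤ C :=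
  energy_germ (ν := 1) d.smooth d.hUc (fun t _ => abs_αhost_le_one t)
    (fun _ ht => abs_βhost_le d.width_pos ht.2)

/-- **THE LEVEL-`0` STAGE of the explicit schedule** (velocity = the line germ).
[cite: Palasek2026ElementaryModel, §3.3] -/
theorem stage : Nonempty (Stage 1 TowerRates.wide d.schedule (Margins.routeG TowerRates.wide) 0) := by
  have hτ0 : d.schedule.τ 0 = 1 := d.schedule_τ_zero
  have hY := Host.wide_Y_zero_pos
  have henergy : ∃ C : ℝ≥0∞, C < ⊤ ∧
      ∀ t ∈ Icc 0 (d.schedule.τ 0), ∫⁻ x, ‖lineVel U σ₀ t x‖ₑ ^ 2 ≤ C := by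
    rw [hτ0]; exact d.energy_vel
  have hcl : IsClassicalNSSolutionOn (Icc 0 (d.schedule.τ 0)) 1 d.schedule.f (lineVel U σ₀)
      (linePres U σ₀) := by
    rw [hτ0]; exact d.isClassicalNSSolutionOn_vel
  refine ⟨{ u := lineVel U σ₀, p := linePres U σ₀, classical := hcl, initial := ?_,
            energy := henergy, floor := ?_, ceiling := ?_, quiet := ?_, margin := ?_ }⟩
  · rw [lineVel_zero]; rfl
  · intro j hj
    obtain rfl := Nat.le_zero.1 hj
    obtain ⟨x, hx, hfl⟩ := d.floor
    refine ⟨x, hx, ?_⟩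
    rw [hτ0, schedule_c₁, one_mul, lineVel_one]
    exact hfl
  · intro j hj t ht x
    obtain rfl := Nat.le_zero.1 hj
    rw [hτ0] at ht
    rw [schedule_c₂]
    have := d.norm_vel_le ht.2 x
    linarith
  · intro j hj
    exact absurd hj (by omega)
  · show (∀ j, j ≤ 0 → ∃ x, ‖x‖ ≤ d.schedule.radius ∧
        d.schedule.c₁ * TowerRates.wide.A j ≤ ‖fderiv ℝ (lineVel U σ₀ (d.schedule.τ j)) x‖) ∧
      (d.schedule.AnchorGlobal (lineVel U σ₀) ∧
        (d.schedule.Rigid ∧ CoreLedger TowerRates.wide d.schedule 0 (lineVel U σ₀)))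
    refine ⟨?_, ?_, d.schedule_rigid, ?_⟩
    · intro j hj
      obtain rfl := Nat.le_zero.1 hj
      obtain ⟨x, hx, hst⟩ := d.strain
      refine ⟨x, hx, ?_⟩
      rw [hτ0, schedule_c₁, one_mul, lineVel_one]
      exact hst
    · intro t ht x
      rw [hτ0] at ht
      rw [schedule_c₁, one_mul]
      exact d.norm_vel_lt ht.2 x
    · intro j hj
      obtain rfl := Nat.le_zero.1 hj
      obtain ⟨x, γ, hx, hγ, hcl', hball, hspeed, hcirc⟩ := d.core
      refine ⟨x, γ, hx, hγ, hcl', hball, hspeed, ?_⟩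
      rw [hτ0, schedule_c₁, one_mul, lineVel_one]
      exact hcirc

/-- **HOST PREPARATION IN THE SINGLETON CLASS OF THE EXPLICIT GERM SCHEDULE** — the first child of the
R2 split for the nameable design `S*(U, ρ, σ₀, ε, c₄)`. [cite: Palasek2026ElementaryModel, §3.3] -/
theorem hostPreparationD_exact : HostPreparationD (HostClass.exact d.schedule) :=
  (hostPreparationD_exact_iff _).2 ⟨d.schedule_pins, d.schedule_rigid, d.schedule_quiet, d.stage⟩

/-- The crux for this design is its episode. [cite: Palasek2026ElementaryModel, §4] -/
theorem episodeBaseG_of_firstEpisodeD (hF : FirstEpisodeD (HostClass.exact d.schedule)) :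
    EpisodeBaseG :=
  episodeBaseG_of_exact _ d.hostPreparationD_exact hF

end LineGermData

/-! ## §3 The link with the abstract slot -/

namespace LevelZeroData

variable {U : EuclideanSpace ℝ (Fin 3) → EuclideanSpace ℝ (Fin 3)} {ρ : ℝ} (h : LevelZeroData U ρ)
include h

/-- **A profile in the abstract slot fills the explicit slot** at the chosen width `σ₀ = h.width` and
fade `ε = h.fadeLen`. [folklore] -/
theorem lineGermData {c₄ : ℝ} (hc₄ : 0 < c₄) (hc₄' : c₄ ≤ 1) :
    LineGermData U ρ h.width (h.fadeLen hc₄) c₄ where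
  smooth := h.smooth
  support := h.support
  divFree := h.divFree
  ceiling := h.ceiling
  floor := h.floor
  strain := h.strain
  core := h.core
  width_pos := h.width_pos
  line := h.width_anchor
  fade_pos := h.fadeLen_pos hc₄
  fade_le := h.fadeLen_le_wfirst hc₄
  push_pos := hc₄
  push_le := hc₄'
  window := h.fadeLen_window hc₄

/-- … and the two schedules are THE SAME (definitionally). [folklore] -/
theorem schedule_eq {c₄ : ℝ} (hc₄ : 0 < c₄) (hc₄' : c₄ ≤ 1) :
    h.schedule c₄ hc₄ hc₄' = (h.lineGermData hc₄ hc₄').schedule := rfl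

end LevelZeroData

end Summit.NavierStokesRegularity.FluidComputer.PalasekTowerClayBridge.Germ

end
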